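/-
Copyright: the b2b-balaban T⁴-continuum CRUX team, row NE7b OWNER lineage `t4-ne7b-p1` (gen 142). Project licence.
-/
import Summits.QuantumFields.BalabanUV.T4Continuum.Spine.NE7b.SupFourthKernelEntryLettersTwo

/-!
# THE FOUR LETTERS OF THE OUTPUT'S FOURTH-ORDER MAJORANT `K4⁺` (the order-4 block of the kernel-letter CLASS MAP, seventh file — the
# instantiation).  (526): `|∂⁴W(ψ)[e_y,e_z,e_t,e_x]| ≤ M_{xyzt}` with `M` written out (constants `C₃ = 4√(MK)`, `M = 5(κ₂⁴+κ₃⁴)γ_op²∕(1−λγ_op)²`,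
# `K = αθ·dθ·βθ·dθ′∕(1−lamA)`; `C₄` the fourth cumulant's tree constant with `M₆` discharged; `c = 1 − lamA`), so `K4⁺_{yztx} := M_{xyzt}` is the
# next step's input majorant; (528)∕(529) summed the abstract `M` with each slot fixed.  Here the four letters WITH (526)'s CONSTANTS:
#   `k4c⁺` (slot 1 of `M`), `k4r⁺` (slot 2), `k4s2⁺` (slot 3), `k4s3⁺` (slot 4) — explicit in the input's `k4r, k4s2, k4s3, k4c`, `k3r, k3m, k3c`,
# `hr, hc`, the factor's `αr, αc, lamA`, the admissible `D`'s plain letters `dr, dc`, the site letters `S, S′`, the support count `n` and the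
# constants `C₃, C₄` — NO symmetry of `∂⁴W` used.  With (484)∕(483) (orders 2–3) this closes the LETTER part of the class map at order 4; the
# operator letter `κ₄⁺ ≤ √(k4s2⁺·k4s3⁺)` is (530) once `∂⁴W` is packaged as a `4`-linear map (row NE7b, node U5c; (528)∕(529) BY NAME; [folklore])

Cell `pub-balaban`, sub-cell `t4`, spine estimate NE7b (`T4WeightBudget.RelWeightBound`; the cell's OWN estimate — NOT PRINTED in
[Bałaban 1983–89], NOT PROVED).  Crux-route work under `Spine/NE7b/` by the row OWNER (`t4-ne7b-p1` gen 142, file (531)) under FREEZE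
(0)'s crux-prover clause; NOTHING of Bałaban's is named as a Lean object, valued or asserted; no `T4Continuum/Support` leaf typed; no
`def`, no notation (`M` WRITTEN OUT with its constants); zero `sorry`.  Imports (BY NAME): the OWNER's (529) `…SupFourthKernelEntryLettersTwo` ((528),
(527) through it).

WHAT IS PROVED ([folklore]): **`output_k4c`**, **`output_k4r`**, **`output_k4s2`**, **`output_k4s3`**; §2 toy.

HONEST (what this is NOT).  Bookkeeping (four instantiations); the constants GROW per step before rescaling ((433)∕(436)); the weighted∕plain `D`
letters, the weights and the profile letters are hypotheses ((485)∕(476)∕(499)∕(510)∕(524) discharge them for a finite-range factor); the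
`C⁴` repackaging and the operator letter of `∂⁴W` are NOT typed; order five NOT typed; scalar skeleton ((A3), NC-NE7b-α UNRULED); nothing of
Bałaban's asserted.  BY-NAME EFFECT ON THE WALL: NONE.  NE7b NOT PRINTED ∕ NOT PROVED; spine PROVED 0∕9; rung (B)+1 — the programme's measures
remain FINITE-torus statements; NOT the mass gap, NOT Clay.  HONEST DEPENDENCY: continuum YM on T⁴ ⇐ BetaPertH ∧ nine spine estimates (0∕9
proved); BetaPertH ⇐ (D1) ∧ (D4) ∧ CAP+tail; G-an2-4 gates asym, D1 and NE2∕3∕4.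
-/

set_option autoImplicit false
set_option maxSynthPendingDepth 3

noncomputable section

namespace Summit.QuantumFields.BalabanUV.T4Continuum.NE7b.SupKernelClassFourthLetters

open Finset Real
open scoped BigOperators
open SupFourthKernelEntryLettersOne (entry_majorant4_slot_one entry_majorant4_slot_two)
open SupFourthKernelEntryLettersTwo (entry_majorant4_slot_three entry_majorant4_slot_four)

variable {ι κ : Type} [Fintype ι] [DecidableEq ι] [Fintype κ] [DecidableEq κ]

section TheEnds

variable {Hk : ι → ι → ℝ} {K3 : ι → ι → ι → ℝ} {K4 : ι → ι → ι → ι → ℝ} {A : Matrix ι κ ℝ} {D : κ → κ → ℝ}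
  {γop κ₂ κ₃ lam lamA αr αc hr hc k3r k3c k3m k4r k4c k4s2 k4s3 dr dc dθ dθ' αθ βθ S S' : ℝ} {ρ r : ι → ι → ℝ} {n : ℕ}

/-! ## §1. THE ENDS: the four letters of `K4⁺` -/

omit [DecidableEq ι] [DecidableEq κ] in
/-- **`k4c⁺`** (`x` fixed, slot 1 of `M` = slot 4 of `K4⁺`): the output's column letter. [folklore] -/
theorem output_k4c [Nonempty κ] (hK40 : ∀ x y z u, 0 ≤ K4 x y z u) (hK30 : ∀ x y u, 0 ≤ K3 x y u) (hHk0 : ∀ v u, 0 ≤ Hk v u)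
    (hαr : ∀ u, ∑ w, |A u w| ≤ αr) (hαc : ∀ w, ∑ u, |A u w| ≤ αc) (hhr : ∀ v, ∑ u, Hk v u ≤ hr) (hhc : ∀ u, ∑ v, Hk v u ≤ hc) (hk3r : ∀ x, ∑ y, ∑ u,
        K3 x y u ≤ k3r) (hk3c : ∀ u, ∑ y, ∑ z, K3 y z u ≤ k3c) (hk4r : ∀ x, ∑ y, ∑ z, ∑ u, K4 x y z u ≤ k4r) (hk4c : ∀ u, ∑ y, ∑ z, ∑ t, K4 y z t u ≤
        k4c) (hn : ∀ b, (Finset.univ.filter (fun a => Hk a b ≠ 0)).card ≤ n) (hrsymm : ∀ x y, r x y = r y x) (hSr : ∀ u, ∑ v, (r u v ^ 2)⁻¹ ≤ S')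
    (hlamA1 : lamA < 1) (hD : ∀ x y, 0 ≤ D x y) (hDr : ∀ z, ∑ w, D z w ≤ dr) (hDc : ∀ w, ∑ z, D z w ≤ dc) (hC3 : 0 ≤ 4 * Real.sqrt ((5 * ((κ₂ ^ 4 +
        κ₃ ^ 4) * γop ^ 2) / (1 - lam * γop) ^ 2) * (αθ * dθ * (βθ * dθ') / (1 - lamA))))
    (hC4 : 0 ≤ (4 * (αθ * dθ * (βθ * dθ') / (1 - lamA)) + 3 * (αθ * dθ * (βθ * dθ') / (1 - lamA)) ^ 2 + 4 * (5 * (κ₂ ^ 4 * γop ^ 2) / (1 - lam * γop)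
        ^ 2) + 4
          * (50 * (κ₂ ^ 6 * γop ^ 3) / (1 - lam * γop) ^ 3) + 2 * (((5 * (κ₂ ^ 4 * γop ^ 2) / (1 - lam * γop) ^ 2) + 1) / 2) * ((((5 * (κ₂ ^ 4 * γop
              ^ 2) / (1 - lam * γop) ^ 2) + 1) / 2) + (5 *
          (κ₂ ^ 4 * γop ^ 2) / (1 - lam * γop) ^ 2))))
    (hρ1 : ∀ x y, 1 ≤ ρ x y) (hS : ∀ x, ∑ y, 1 / ρ x y ≤ S) (x : ι) :
    ∑ y, ∑ z, ∑ t, (K4 y z t x + ∑ w, (∑ z', D z' w * ∑ u, |A u z'| * K4 x z t u) * (∑ z', D z' w * ∑ u, |A u z'| * Hk y u) / (1 - lamA) + ∑ w, (∑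
        z', D z' w * ∑ u, |A u z'| * K4 x y t u) * (∑ z', D z' w * ∑ u, |A u z'| * Hk z u) / (1 - lamA) +
        ∑ w, (∑ z', D z' w * ∑ u, |A u z'| * K4 x y z u) * (∑ z', D z' w * ∑ u, |A u z'| * Hk t u) / (1 - lamA) + ∑ w, (∑ z', D z' w * ∑ u, |A u z'|
            * Hk x u) * (∑ z', D z' w * ∑ u, |A u z'| * K4 y z t u) / (1 - lamA) +
        ∑ w, (∑ z', D z' w * ∑ u, |A u z'| * K3 x y u) * (∑ z', D z' w * ∑ u, |A u z'| * K3 z t u) / (1 - lamA) + ∑ w, (∑ z', D z' w * ∑ u, |A u z'|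
            * K3 x z u) * (∑ z', D z' w * ∑ u, |A u z'| * K3 y t u) / (1 - lamA) +
        ∑ w, (∑ z', D z' w * ∑ u, |A u z'| * K3 x t u) * (∑ z', D z' w * ∑ u, |A u z'| * K3 y z u) / (1 - lamA) +
        (if Hk y x = 0 then (0 : ℝ) else 4 * Real.sqrt ((5 * ((κ₂ ^ 4 + κ₃ ^ 4) * γop ^ 2) / (1 - lam * γop) ^ 2) * (αθ * dθ * (βθ * dθ') / (1 -
            lamA))) / (ρ x z * ρ x t)) + (if Hk z x = 0 then (0 : ℝ) else 4 * Real.sqrt ((5 * ((κ₂ ^ 4 + κ₃ ^ 4) * γop ^ 2) / (1 - lam * γop) ^ 2) *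
            (αθ * dθ * (βθ * dθ') / (1 - lamA))) / (ρ x y * ρ x t)) +
        (if Hk t x = 0 then (0 : ℝ) else 4 * Real.sqrt ((5 * ((κ₂ ^ 4 + κ₃ ^ 4) * γop ^ 2) / (1 - lam * γop) ^ 2) * (αθ * dθ * (βθ * dθ') / (1 -
            lamA))) / (ρ x y * ρ x z)) + (if Hk z y = 0 then (0 : ℝ) else 4 * Real.sqrt ((5 * ((κ₂ ^ 4 + κ₃ ^ 4) * γop ^ 2) / (1 - lam * γop) ^ 2) *
            (αθ * dθ * (βθ * dθ') / (1 - lamA))) / (ρ x y * ρ x t)) +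
        (if Hk t y = 0 then (0 : ℝ) else 4 * Real.sqrt ((5 * ((κ₂ ^ 4 + κ₃ ^ 4) * γop ^ 2) / (1 - lam * γop) ^ 2) * (αθ * dθ * (βθ * dθ') / (1 -
            lamA))) / (ρ x y * ρ x z)) + (if Hk t z = 0 then (0 : ℝ) else 4 * Real.sqrt ((5 * ((κ₂ ^ 4 + κ₃ ^ 4) * γop ^ 2) / (1 - lam * γop) ^ 2) *
            (αθ * dθ * (βθ * dθ') / (1 - lamA))) / (ρ x z * ρ x y)) +
        (4 * (αθ * dθ * (βθ * dθ') / (1 - lamA)) + 3 * (αθ * dθ * (βθ * dθ') / (1 - lamA)) ^ 2 + 4 * (5 * (κ₂ ^ 4 * γop ^ 2) / (1 - lam * γop) ^ 2) +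
            4
          * (50 * (κ₂ ^ 6 * γop ^ 3) / (1 - lam * γop) ^ 3) + 2 * (((5 * (κ₂ ^ 4 * γop ^ 2) / (1 - lam * γop) ^ 2) + 1) / 2) * ((((5 * (κ₂ ^ 4 * γop
              ^ 2) / (1 - lam * γop) ^ 2) + 1) / 2) + (5 *
          (κ₂ ^ 4 * γop ^ 2) / (1 - lam * γop) ^ 2))) *
        ((r x y ^ 2)⁻¹ * (r x z ^ 2)⁻¹ * (r x t ^ 2)⁻¹ + (r x y ^ 2)⁻¹ * (r y z ^ 2)⁻¹ * (r y t ^ 2)⁻¹ + (r x z ^ 2)⁻¹ * (r y z ^ 2)⁻¹ * (r z t ^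
            2)⁻¹ + (r x t ^ 2)⁻¹ * (r y t ^ 2)⁻¹ * (r z t ^ 2)⁻¹ + (r x y ^ 2)⁻¹ * (r y z ^ 2)⁻¹ * (r z t ^ 2)⁻¹ + (r x y ^ 2)⁻¹ * (r y t ^ 2)⁻¹ * (r
            z t ^ 2)⁻¹ + (r x z ^ 2)⁻¹ * (r y z ^ 2)⁻¹ * (r y t ^ 2)⁻¹ + (r x z ^ 2)⁻¹ * (r y t ^ 2)⁻¹ * (r z t ^ 2)⁻¹ + (r x t ^ 2)⁻¹ * (r y z ^
            2)⁻¹ * (r y t ^ 2)⁻¹ + (r x t ^ 2)⁻¹ * (r y z ^ 2)⁻¹ * (r z t ^ 2)⁻¹ + (r x y ^ 2)⁻¹ * (r x z ^ 2)⁻¹ * (r z t ^ 2)⁻¹ + (r x y ^ 2)⁻¹ * (r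
            x t ^ 2)⁻¹ * (r z t ^ 2)⁻¹ + (r x y ^ 2)⁻¹ * (r x z ^ 2)⁻¹ * (r y t ^ 2)⁻¹ + (r x z ^ 2)⁻¹ * (r x t ^ 2)⁻¹ * (r y t ^ 2)⁻¹ + (r x y ^
            2)⁻¹ * (r x t ^ 2)⁻¹ * (r y z ^ 2)⁻¹ + (r x z ^ 2)⁻¹ * (r x t ^ 2)⁻¹ * (r y z ^ 2)⁻¹)) ≤
      k4c + (3 * (αr * k4r * (αc * hc)) + hr * αr * (αc * k4c) + 3 * (αr * k3r * (αc * k3c))) * dr * dc / (1 - lamA) + 6 * ((n : ℝ) * ((4 * Real.sqrt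
          ((5 * ((κ₂ ^ 4 + κ₃ ^ 4) * γop ^ 2) / (1 - lam * γop) ^ 2) * (αθ * dθ * (βθ * dθ') / (1 - lamA)))) * S ^ 2)) +
        (4 * (αθ * dθ * (βθ * dθ') / (1 - lamA)) + 3 * (αθ * dθ * (βθ * dθ') / (1 - lamA)) ^ 2 + 4 * (5 * (κ₂ ^ 4 * γop ^ 2) / (1 - lam * γop) ^ 2) +
            4
          * (50 * (κ₂ ^ 6 * γop ^ 3) / (1 - lam * γop) ^ 3) + 2 * (((5 * (κ₂ ^ 4 * γop ^ 2) / (1 - lam * γop) ^ 2) + 1) / 2) * ((((5 * (κ₂ ^ 4 * γop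
              ^ 2) / (1 - lam * γop) ^ 2) + 1) / 2) + (5 *
          (κ₂ ^ 4 * γop ^ 2) / (1 - lam * γop) ^ 2))) * (16 * S' ^ 3) := by
  have hl1 : 0 < 1 - lamA := by linarith
  exact entry_majorant4_slot_one hK40 hK30 hHk0 hαr hαc hhr hhc hk3r hk3c hk4r hk4c hn hrsymm hSr hD hDr hDc hl1 hC3 hC4 hρ1 hS x

omit [DecidableEq ι] [DecidableEq κ] in
/-- **`k4r⁺`** (`y` fixed, slot 2 of `M` = slot 1 of `K4⁺`): the output's row letter. [folklore] -/
theorem output_k4r [Nonempty κ] (hK40 : ∀ x y z u, 0 ≤ K4 x y z u) (hK30 : ∀ x y u, 0 ≤ K3 x y u) (hHk0 : ∀ v u, 0 ≤ Hk v u)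
    (hαr : ∀ u, ∑ w, |A u w| ≤ αr) (hαc : ∀ w, ∑ u, |A u w| ≤ αc) (hhr : ∀ v, ∑ u, Hk v u ≤ hr) (hhc : ∀ u, ∑ v, Hk v u ≤ hc) (hk3r : ∀ x, ∑ y, ∑ u,
        K3 x y u ≤ k3r) (hk3c : ∀ u, ∑ y, ∑ z, K3 y z u ≤ k3c) (hk3m : ∀ y, ∑ x, ∑ u, K3 x y u ≤ k3m) (hk4r : ∀ x, ∑ y, ∑ z, ∑ u, K4 x y z u ≤ k4r)
        (hk4c : ∀ u, ∑ y, ∑ z, ∑ t, K4 y z t u ≤ k4c) (hk4s2 : ∀ y, ∑ x, ∑ t, ∑ u, K4 x y t u ≤ k4s2) (hρsymm : ∀ x y, ρ x y = ρ y x) (hn : ∀ b,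
        (Finset.univ.filter (fun a => Hk a b ≠ 0)).card ≤ n) (hn' : ∀ a, (Finset.univ.filter (fun b => Hk a b ≠ 0)).card ≤ n) (hrsymm : ∀ x y, r x y
        = r y x) (hSr : ∀ u, ∑ v, (r u v ^ 2)⁻¹ ≤ S')
    (hlamA1 : lamA < 1) (hD : ∀ x y, 0 ≤ D x y) (hDr : ∀ z, ∑ w, D z w ≤ dr) (hDc : ∀ w, ∑ z, D z w ≤ dc) (hC3 : 0 ≤ 4 * Real.sqrt ((5 * ((κ₂ ^ 4 +
        κ₃ ^ 4) * γop ^ 2) / (1 - lam * γop) ^ 2) * (αθ * dθ * (βθ * dθ') / (1 - lamA))))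
    (hC4 : 0 ≤ (4 * (αθ * dθ * (βθ * dθ') / (1 - lamA)) + 3 * (αθ * dθ * (βθ * dθ') / (1 - lamA)) ^ 2 + 4 * (5 * (κ₂ ^ 4 * γop ^ 2) / (1 - lam * γop)
        ^ 2) + 4
          * (50 * (κ₂ ^ 6 * γop ^ 3) / (1 - lam * γop) ^ 3) + 2 * (((5 * (κ₂ ^ 4 * γop ^ 2) / (1 - lam * γop) ^ 2) + 1) / 2) * ((((5 * (κ₂ ^ 4 * γop
              ^ 2) / (1 - lam * γop) ^ 2) + 1) / 2) + (5 *
          (κ₂ ^ 4 * γop ^ 2) / (1 - lam * γop) ^ 2))))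
    (hρ1 : ∀ x y, 1 ≤ ρ x y) (hS : ∀ x, ∑ y, 1 / ρ x y ≤ S) (y : ι) :
    ∑ x, ∑ z, ∑ t, (K4 y z t x + ∑ w, (∑ z', D z' w * ∑ u, |A u z'| * K4 x z t u) * (∑ z', D z' w * ∑ u, |A u z'| * Hk y u) / (1 - lamA) + ∑ w, (∑
        z', D z' w * ∑ u, |A u z'| * K4 x y t u) * (∑ z', D z' w * ∑ u, |A u z'| * Hk z u) / (1 - lamA) +
        ∑ w, (∑ z', D z' w * ∑ u, |A u z'| * K4 x y z u) * (∑ z', D z' w * ∑ u, |A u z'| * Hk t u) / (1 - lamA) + ∑ w, (∑ z', D z' w * ∑ u, |A u z'|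
            * Hk x u) * (∑ z', D z' w * ∑ u, |A u z'| * K4 y z t u) / (1 - lamA) +
        ∑ w, (∑ z', D z' w * ∑ u, |A u z'| * K3 x y u) * (∑ z', D z' w * ∑ u, |A u z'| * K3 z t u) / (1 - lamA) + ∑ w, (∑ z', D z' w * ∑ u, |A u z'|
            * K3 x z u) * (∑ z', D z' w * ∑ u, |A u z'| * K3 y t u) / (1 - lamA) +
        ∑ w, (∑ z', D z' w * ∑ u, |A u z'| * K3 x t u) * (∑ z', D z' w * ∑ u, |A u z'| * K3 y z u) / (1 - lamA) +
        (if Hk y x = 0 then (0 : ℝ) else 4 * Real.sqrt ((5 * ((κ₂ ^ 4 + κ₃ ^ 4) * γop ^ 2) / (1 - lam * γop) ^ 2) * (αθ * dθ * (βθ * dθ') / (1 -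
            lamA))) / (ρ x z * ρ x t)) + (if Hk z x = 0 then (0 : ℝ) else 4 * Real.sqrt ((5 * ((κ₂ ^ 4 + κ₃ ^ 4) * γop ^ 2) / (1 - lam * γop) ^ 2) *
            (αθ * dθ * (βθ * dθ') / (1 - lamA))) / (ρ x y * ρ x t)) +
        (if Hk t x = 0 then (0 : ℝ) else 4 * Real.sqrt ((5 * ((κ₂ ^ 4 + κ₃ ^ 4) * γop ^ 2) / (1 - lam * γop) ^ 2) * (αθ * dθ * (βθ * dθ') / (1 -
            lamA))) / (ρ x y * ρ x z)) + (if Hk z y = 0 then (0 : ℝ) else 4 * Real.sqrt ((5 * ((κ₂ ^ 4 + κ₃ ^ 4) * γop ^ 2) / (1 - lam * γop) ^ 2) *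
            (αθ * dθ * (βθ * dθ') / (1 - lamA))) / (ρ x y * ρ x t)) +
        (if Hk t y = 0 then (0 : ℝ) else 4 * Real.sqrt ((5 * ((κ₂ ^ 4 + κ₃ ^ 4) * γop ^ 2) / (1 - lam * γop) ^ 2) * (αθ * dθ * (βθ * dθ') / (1 -
            lamA))) / (ρ x y * ρ x z)) + (if Hk t z = 0 then (0 : ℝ) else 4 * Real.sqrt ((5 * ((κ₂ ^ 4 + κ₃ ^ 4) * γop ^ 2) / (1 - lam * γop) ^ 2) *
            (αθ * dθ * (βθ * dθ') / (1 - lamA))) / (ρ x z * ρ x y)) +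
        (4 * (αθ * dθ * (βθ * dθ') / (1 - lamA)) + 3 * (αθ * dθ * (βθ * dθ') / (1 - lamA)) ^ 2 + 4 * (5 * (κ₂ ^ 4 * γop ^ 2) / (1 - lam * γop) ^ 2) +
            4
          * (50 * (κ₂ ^ 6 * γop ^ 3) / (1 - lam * γop) ^ 3) + 2 * (((5 * (κ₂ ^ 4 * γop ^ 2) / (1 - lam * γop) ^ 2) + 1) / 2) * ((((5 * (κ₂ ^ 4 * γop
              ^ 2) / (1 - lam * γop) ^ 2) + 1) / 2) + (5 *
          (κ₂ ^ 4 * γop ^ 2) / (1 - lam * γop) ^ 2))) *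
        ((r x y ^ 2)⁻¹ * (r x z ^ 2)⁻¹ * (r x t ^ 2)⁻¹ + (r x y ^ 2)⁻¹ * (r y z ^ 2)⁻¹ * (r y t ^ 2)⁻¹ + (r x z ^ 2)⁻¹ * (r y z ^ 2)⁻¹ * (r z t ^
            2)⁻¹ + (r x t ^ 2)⁻¹ * (r y t ^ 2)⁻¹ * (r z t ^ 2)⁻¹ + (r x y ^ 2)⁻¹ * (r y z ^ 2)⁻¹ * (r z t ^ 2)⁻¹ + (r x y ^ 2)⁻¹ * (r y t ^ 2)⁻¹ * (r
            z t ^ 2)⁻¹ + (r x z ^ 2)⁻¹ * (r y z ^ 2)⁻¹ * (r y t ^ 2)⁻¹ + (r x z ^ 2)⁻¹ * (r y t ^ 2)⁻¹ * (r z t ^ 2)⁻¹ + (r x t ^ 2)⁻¹ * (r y z ^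
            2)⁻¹ * (r y t ^ 2)⁻¹ + (r x t ^ 2)⁻¹ * (r y z ^ 2)⁻¹ * (r z t ^ 2)⁻¹ + (r x y ^ 2)⁻¹ * (r x z ^ 2)⁻¹ * (r z t ^ 2)⁻¹ + (r x y ^ 2)⁻¹ * (r
            x t ^ 2)⁻¹ * (r z t ^ 2)⁻¹ + (r x y ^ 2)⁻¹ * (r x z ^ 2)⁻¹ * (r y t ^ 2)⁻¹ + (r x z ^ 2)⁻¹ * (r x t ^ 2)⁻¹ * (r y t ^ 2)⁻¹ + (r x y ^
            2)⁻¹ * (r x t ^ 2)⁻¹ * (r y z ^ 2)⁻¹ + (r x z ^ 2)⁻¹ * (r x t ^ 2)⁻¹ * (r y z ^ 2)⁻¹)) ≤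
      k4r + (hr * αr * (αc * k4c) + 2 * (αr * k4s2 * (αc * hc)) + αr * k4r * (αc * hc) + αr * k3m * (αc * k3c) + 2 * (αr * k3r * (αc * k3c))) *
        dr * dc / (1 - lamA) + 6 * ((n : ℝ) * ((4 * Real.sqrt ((5 * ((κ₂ ^ 4 + κ₃ ^ 4) * γop ^ 2) / (1 - lam * γop) ^ 2) * (αθ * dθ * (βθ * dθ') / (1
            - lamA)))) * S ^ 2)) + (4 * (αθ * dθ * (βθ * dθ') / (1 - lamA)) + 3 * (αθ * dθ * (βθ * dθ') / (1 - lamA)) ^ 2 + 4 * (5 * (κ₂ ^ 4 * γop ^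
            2) / (1 - lam * γop) ^ 2) + 4
          * (50 * (κ₂ ^ 6 * γop ^ 3) / (1 - lam * γop) ^ 3) + 2 * (((5 * (κ₂ ^ 4 * γop ^ 2) / (1 - lam * γop) ^ 2) + 1) / 2) * ((((5 * (κ₂ ^ 4 * γop
              ^ 2) / (1 - lam * γop) ^ 2) + 1) / 2) + (5 *
          (κ₂ ^ 4 * γop ^ 2) / (1 - lam * γop) ^ 2))) * (16 * S' ^ 3) := by
  have hl1 : 0 < 1 - lamA := by linarith
  exact entry_majorant4_slot_two hK40 hK30 hHk0 hαr hαc hhr hhc hk3r hk3c hk3m hk4r hk4c hk4s2 hρsymm hn hn' hrsymm hSr hD hDr hDc hl1 hC3 hC4 hρ1 hS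
      y

omit [DecidableEq ι] [DecidableEq κ] in
/-- **`k4s2⁺`** (`z` fixed, slot 3 of `M` = slot 2 of `K4⁺`). [folklore] -/
theorem output_k4s2 [Nonempty κ] (hK40 : ∀ x y z u, 0 ≤ K4 x y z u) (hK30 : ∀ x y u, 0 ≤ K3 x y u) (hHk0 : ∀ v u, 0 ≤ Hk v u)
    (hαr : ∀ u, ∑ w, |A u w| ≤ αr) (hαc : ∀ w, ∑ u, |A u w| ≤ αc) (hhr : ∀ v, ∑ u, Hk v u ≤ hr) (hhc : ∀ u, ∑ v, Hk v u ≤ hc) (hk3r : ∀ x, ∑ y, ∑ u,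
        K3 x y u ≤ k3r) (hk3c : ∀ u, ∑ y, ∑ z, K3 y z u ≤ k3c) (hk3m : ∀ y, ∑ x, ∑ u, K3 x y u ≤ k3m) (hk4c : ∀ u, ∑ y, ∑ z, ∑ t, K4 y z t u ≤ k4c)
        (hk4s2 : ∀ y, ∑ x, ∑ t, ∑ u, K4 x y t u ≤ k4s2) (hk4s3 : ∀ z, ∑ x, ∑ y, ∑ u, K4 x y z u ≤ k4s3) (hρsymm : ∀ x y, ρ x y = ρ y x) (hn : ∀ b,
        (Finset.univ.filter (fun a => Hk a b ≠ 0)).card ≤ n) (hn' : ∀ a, (Finset.univ.filter (fun b => Hk a b ≠ 0)).card ≤ n) (hrsymm : ∀ x y, r x y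
        = r y x) (hSr : ∀ u, ∑ v, (r u v ^ 2)⁻¹ ≤ S')
    (hlamA1 : lamA < 1) (hD : ∀ x y, 0 ≤ D x y) (hDr : ∀ z, ∑ w, D z w ≤ dr) (hDc : ∀ w, ∑ z, D z w ≤ dc) (hC3 : 0 ≤ 4 * Real.sqrt ((5 * ((κ₂ ^ 4 +
        κ₃ ^ 4) * γop ^ 2) / (1 - lam * γop) ^ 2) * (αθ * dθ * (βθ * dθ') / (1 - lamA))))
    (hC4 : 0 ≤ (4 * (αθ * dθ * (βθ * dθ') / (1 - lamA)) + 3 * (αθ * dθ * (βθ * dθ') / (1 - lamA)) ^ 2 + 4 * (5 * (κ₂ ^ 4 * γop ^ 2) / (1 - lam * γop)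
        ^ 2) + 4
          * (50 * (κ₂ ^ 6 * γop ^ 3) / (1 - lam * γop) ^ 3) + 2 * (((5 * (κ₂ ^ 4 * γop ^ 2) / (1 - lam * γop) ^ 2) + 1) / 2) * ((((5 * (κ₂ ^ 4 * γop
              ^ 2) / (1 - lam * γop) ^ 2) + 1) / 2) + (5 *
          (κ₂ ^ 4 * γop ^ 2) / (1 - lam * γop) ^ 2))))
    (hρ1 : ∀ x y, 1 ≤ ρ x y) (hS : ∀ x, ∑ y, 1 / ρ x y ≤ S) (z : ι) :
    ∑ x, ∑ y, ∑ t, (K4 y z t x + ∑ w, (∑ z', D z' w * ∑ u, |A u z'| * K4 x z t u) * (∑ z', D z' w * ∑ u, |A u z'| * Hk y u) / (1 - lamA) + ∑ w, (∑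
        z', D z' w * ∑ u, |A u z'| * K4 x y t u) * (∑ z', D z' w * ∑ u, |A u z'| * Hk z u) / (1 - lamA) +
        ∑ w, (∑ z', D z' w * ∑ u, |A u z'| * K4 x y z u) * (∑ z', D z' w * ∑ u, |A u z'| * Hk t u) / (1 - lamA) + ∑ w, (∑ z', D z' w * ∑ u, |A u z'|
            * Hk x u) * (∑ z', D z' w * ∑ u, |A u z'| * K4 y z t u) / (1 - lamA) +
        ∑ w, (∑ z', D z' w * ∑ u, |A u z'| * K3 x y u) * (∑ z', D z' w * ∑ u, |A u z'| * K3 z t u) / (1 - lamA) + ∑ w, (∑ z', D z' w * ∑ u, |A u z'|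
            * K3 x z u) * (∑ z', D z' w * ∑ u, |A u z'| * K3 y t u) / (1 - lamA) +
        ∑ w, (∑ z', D z' w * ∑ u, |A u z'| * K3 x t u) * (∑ z', D z' w * ∑ u, |A u z'| * K3 y z u) / (1 - lamA) +
        (if Hk y x = 0 then (0 : ℝ) else 4 * Real.sqrt ((5 * ((κ₂ ^ 4 + κ₃ ^ 4) * γop ^ 2) / (1 - lam * γop) ^ 2) * (αθ * dθ * (βθ * dθ') / (1 -
            lamA))) / (ρ x z * ρ x t)) + (if Hk z x = 0 then (0 : ℝ) else 4 * Real.sqrt ((5 * ((κ₂ ^ 4 + κ₃ ^ 4) * γop ^ 2) / (1 - lam * γop) ^ 2) *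
            (αθ * dθ * (βθ * dθ') / (1 - lamA))) / (ρ x y * ρ x t)) +
        (if Hk t x = 0 then (0 : ℝ) else 4 * Real.sqrt ((5 * ((κ₂ ^ 4 + κ₃ ^ 4) * γop ^ 2) / (1 - lam * γop) ^ 2) * (αθ * dθ * (βθ * dθ') / (1 -
            lamA))) / (ρ x y * ρ x z)) + (if Hk z y = 0 then (0 : ℝ) else 4 * Real.sqrt ((5 * ((κ₂ ^ 4 + κ₃ ^ 4) * γop ^ 2) / (1 - lam * γop) ^ 2) *
            (αθ * dθ * (βθ * dθ') / (1 - lamA))) / (ρ x y * ρ x t)) +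
        (if Hk t y = 0 then (0 : ℝ) else 4 * Real.sqrt ((5 * ((κ₂ ^ 4 + κ₃ ^ 4) * γop ^ 2) / (1 - lam * γop) ^ 2) * (αθ * dθ * (βθ * dθ') / (1 -
            lamA))) / (ρ x y * ρ x z)) + (if Hk t z = 0 then (0 : ℝ) else 4 * Real.sqrt ((5 * ((κ₂ ^ 4 + κ₃ ^ 4) * γop ^ 2) / (1 - lam * γop) ^ 2) *
            (αθ * dθ * (βθ * dθ') / (1 - lamA))) / (ρ x z * ρ x y)) +
        (4 * (αθ * dθ * (βθ * dθ') / (1 - lamA)) + 3 * (αθ * dθ * (βθ * dθ') / (1 - lamA)) ^ 2 + 4 * (5 * (κ₂ ^ 4 * γop ^ 2) / (1 - lam * γop) ^ 2) +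
            4
          * (50 * (κ₂ ^ 6 * γop ^ 3) / (1 - lam * γop) ^ 3) + 2 * (((5 * (κ₂ ^ 4 * γop ^ 2) / (1 - lam * γop) ^ 2) + 1) / 2) * ((((5 * (κ₂ ^ 4 * γop
              ^ 2) / (1 - lam * γop) ^ 2) + 1) / 2) + (5 *
          (κ₂ ^ 4 * γop ^ 2) / (1 - lam * γop) ^ 2))) *
        ((r x y ^ 2)⁻¹ * (r x z ^ 2)⁻¹ * (r x t ^ 2)⁻¹ + (r x y ^ 2)⁻¹ * (r y z ^ 2)⁻¹ * (r y t ^ 2)⁻¹ + (r x z ^ 2)⁻¹ * (r y z ^ 2)⁻¹ * (r z t ^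
            2)⁻¹ + (r x t ^ 2)⁻¹ * (r y t ^ 2)⁻¹ * (r z t ^ 2)⁻¹ + (r x y ^ 2)⁻¹ * (r y z ^ 2)⁻¹ * (r z t ^ 2)⁻¹ + (r x y ^ 2)⁻¹ * (r y t ^ 2)⁻¹ * (r
            z t ^ 2)⁻¹ + (r x z ^ 2)⁻¹ * (r y z ^ 2)⁻¹ * (r y t ^ 2)⁻¹ + (r x z ^ 2)⁻¹ * (r y t ^ 2)⁻¹ * (r z t ^ 2)⁻¹ + (r x t ^ 2)⁻¹ * (r y z ^
            2)⁻¹ * (r y t ^ 2)⁻¹ + (r x t ^ 2)⁻¹ * (r y z ^ 2)⁻¹ * (r z t ^ 2)⁻¹ + (r x y ^ 2)⁻¹ * (r x z ^ 2)⁻¹ * (r z t ^ 2)⁻¹ + (r x y ^ 2)⁻¹ * (r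
            x t ^ 2)⁻¹ * (r z t ^ 2)⁻¹ + (r x y ^ 2)⁻¹ * (r x z ^ 2)⁻¹ * (r y t ^ 2)⁻¹ + (r x z ^ 2)⁻¹ * (r x t ^ 2)⁻¹ * (r y t ^ 2)⁻¹ + (r x y ^
            2)⁻¹ * (r x t ^ 2)⁻¹ * (r y z ^ 2)⁻¹ + (r x z ^ 2)⁻¹ * (r x t ^ 2)⁻¹ * (r y z ^ 2)⁻¹)) ≤
      k4s2 + (2 * (αr * k4s2 * (αc * hc)) + hr * αr * (αc * k4c) + αr * k4s3 * (αc * hc) + αr * k3r * (αc * k3c) + 2 * (αr * k3m * (αc * k3c))) *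
        dr * dc / (1 - lamA) + 6 * ((n : ℝ) * ((4 * Real.sqrt ((5 * ((κ₂ ^ 4 + κ₃ ^ 4) * γop ^ 2) / (1 - lam * γop) ^ 2) * (αθ * dθ * (βθ * dθ') / (1
            - lamA)))) * S ^ 2)) + (4 * (αθ * dθ * (βθ * dθ') / (1 - lamA)) + 3 * (αθ * dθ * (βθ * dθ') / (1 - lamA)) ^ 2 + 4 * (5 * (κ₂ ^ 4 * γop ^
            2) / (1 - lam * γop) ^ 2) + 4
          * (50 * (κ₂ ^ 6 * γop ^ 3) / (1 - lam * γop) ^ 3) + 2 * (((5 * (κ₂ ^ 4 * γop ^ 2) / (1 - lam * γop) ^ 2) + 1) / 2) * ((((5 * (κ₂ ^ 4 * γop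
              ^ 2) / (1 - lam * γop) ^ 2) + 1) / 2) + (5 *
          (κ₂ ^ 4 * γop ^ 2) / (1 - lam * γop) ^ 2))) * (16 * S' ^ 3) := by
  have hl1 : 0 < 1 - lamA := by linarith
  exact entry_majorant4_slot_three hK40 hK30 hHk0 hαr hαc hhr hhc hk3r hk3c hk3m hk4c hk4s2 hk4s3 hρsymm hn hn' hrsymm hSr hD hDr hDc hl1 hC3 hC4 hρ1
      hS z

omit [DecidableEq ι] [DecidableEq κ] in
/-- **`k4s3⁺`** (`t` fixed, slot 4 of `M` = slot 3 of `K4⁺`). [folklore] -/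
theorem output_k4s3 [Nonempty κ] (hK40 : ∀ x y z u, 0 ≤ K4 x y z u) (hK30 : ∀ x y u, 0 ≤ K3 x y u) (hHk0 : ∀ v u, 0 ≤ Hk v u)
    (hαr : ∀ u, ∑ w, |A u w| ≤ αr) (hαc : ∀ w, ∑ u, |A u w| ≤ αc) (hhr : ∀ v, ∑ u, Hk v u ≤ hr) (hhc : ∀ u, ∑ v, Hk v u ≤ hc) (hk3c : ∀ u, ∑ y, ∑ z,
        K3 y z u ≤ k3c) (hk3m : ∀ y, ∑ x, ∑ u, K3 x y u ≤ k3m) (hk4c : ∀ u, ∑ y, ∑ z, ∑ t, K4 y z t u ≤ k4c) (hk4s3 : ∀ z, ∑ x, ∑ y, ∑ u, K4 x y z u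
        ≤ k4s3) (hρsymm : ∀ x y, ρ x y = ρ y x) (hn : ∀ b, (Finset.univ.filter (fun a => Hk a b ≠ 0)).card ≤ n) (hn' : ∀ a, (Finset.univ.filter (fun
        b => Hk a b ≠ 0)).card ≤ n) (hrsymm : ∀ x y, r x y = r y x) (hSr : ∀ u, ∑ v, (r u v ^ 2)⁻¹ ≤ S')
    (hlamA1 : lamA < 1) (hD : ∀ x y, 0 ≤ D x y) (hDr : ∀ z, ∑ w, D z w ≤ dr) (hDc : ∀ w, ∑ z, D z w ≤ dc) (hC3 : 0 ≤ 4 * Real.sqrt ((5 * ((κ₂ ^ 4 +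
        κ₃ ^ 4) * γop ^ 2) / (1 - lam * γop) ^ 2) * (αθ * dθ * (βθ * dθ') / (1 - lamA))))
    (hC4 : 0 ≤ (4 * (αθ * dθ * (βθ * dθ') / (1 - lamA)) + 3 * (αθ * dθ * (βθ * dθ') / (1 - lamA)) ^ 2 + 4 * (5 * (κ₂ ^ 4 * γop ^ 2) / (1 - lam * γop)
        ^ 2) + 4
          * (50 * (κ₂ ^ 6 * γop ^ 3) / (1 - lam * γop) ^ 3) + 2 * (((5 * (κ₂ ^ 4 * γop ^ 2) / (1 - lam * γop) ^ 2) + 1) / 2) * ((((5 * (κ₂ ^ 4 * γop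
              ^ 2) / (1 - lam * γop) ^ 2) + 1) / 2) + (5 *
          (κ₂ ^ 4 * γop ^ 2) / (1 - lam * γop) ^ 2))))
    (hρ1 : ∀ x y, 1 ≤ ρ x y) (hS : ∀ x, ∑ y, 1 / ρ x y ≤ S) (t : ι) :
    ∑ x, ∑ y, ∑ z, (K4 y z t x + ∑ w, (∑ z', D z' w * ∑ u, |A u z'| * K4 x z t u) * (∑ z', D z' w * ∑ u, |A u z'| * Hk y u) / (1 - lamA) + ∑ w, (∑
        z', D z' w * ∑ u, |A u z'| * K4 x y t u) * (∑ z', D z' w * ∑ u, |A u z'| * Hk z u) / (1 - lamA) +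
        ∑ w, (∑ z', D z' w * ∑ u, |A u z'| * K4 x y z u) * (∑ z', D z' w * ∑ u, |A u z'| * Hk t u) / (1 - lamA) + ∑ w, (∑ z', D z' w * ∑ u, |A u z'|
            * Hk x u) * (∑ z', D z' w * ∑ u, |A u z'| * K4 y z t u) / (1 - lamA) +
        ∑ w, (∑ z', D z' w * ∑ u, |A u z'| * K3 x y u) * (∑ z', D z' w * ∑ u, |A u z'| * K3 z t u) / (1 - lamA) + ∑ w, (∑ z', D z' w * ∑ u, |A u z'|
            * K3 x z u) * (∑ z', D z' w * ∑ u, |A u z'| * K3 y t u) / (1 - lamA) +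
        ∑ w, (∑ z', D z' w * ∑ u, |A u z'| * K3 x t u) * (∑ z', D z' w * ∑ u, |A u z'| * K3 y z u) / (1 - lamA) +
        (if Hk y x = 0 then (0 : ℝ) else 4 * Real.sqrt ((5 * ((κ₂ ^ 4 + κ₃ ^ 4) * γop ^ 2) / (1 - lam * γop) ^ 2) * (αθ * dθ * (βθ * dθ') / (1 -
            lamA))) / (ρ x z * ρ x t)) + (if Hk z x = 0 then (0 : ℝ) else 4 * Real.sqrt ((5 * ((κ₂ ^ 4 + κ₃ ^ 4) * γop ^ 2) / (1 - lam * γop) ^ 2) *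
            (αθ * dθ * (βθ * dθ') / (1 - lamA))) / (ρ x y * ρ x t)) +
        (if Hk t x = 0 then (0 : ℝ) else 4 * Real.sqrt ((5 * ((κ₂ ^ 4 + κ₃ ^ 4) * γop ^ 2) / (1 - lam * γop) ^ 2) * (αθ * dθ * (βθ * dθ') / (1 -
            lamA))) / (ρ x y * ρ x z)) + (if Hk z y = 0 then (0 : ℝ) else 4 * Real.sqrt ((5 * ((κ₂ ^ 4 + κ₃ ^ 4) * γop ^ 2) / (1 - lam * γop) ^ 2) *
            (αθ * dθ * (βθ * dθ') / (1 - lamA))) / (ρ x y * ρ x t)) +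
        (if Hk t y = 0 then (0 : ℝ) else 4 * Real.sqrt ((5 * ((κ₂ ^ 4 + κ₃ ^ 4) * γop ^ 2) / (1 - lam * γop) ^ 2) * (αθ * dθ * (βθ * dθ') / (1 -
            lamA))) / (ρ x y * ρ x z)) + (if Hk t z = 0 then (0 : ℝ) else 4 * Real.sqrt ((5 * ((κ₂ ^ 4 + κ₃ ^ 4) * γop ^ 2) / (1 - lam * γop) ^ 2) *
            (αθ * dθ * (βθ * dθ') / (1 - lamA))) / (ρ x z * ρ x y)) +
        (4 * (αθ * dθ * (βθ * dθ') / (1 - lamA)) + 3 * (αθ * dθ * (βθ * dθ') / (1 - lamA)) ^ 2 + 4 * (5 * (κ₂ ^ 4 * γop ^ 2) / (1 - lam * γop) ^ 2) +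
            4
          * (50 * (κ₂ ^ 6 * γop ^ 3) / (1 - lam * γop) ^ 3) + 2 * (((5 * (κ₂ ^ 4 * γop ^ 2) / (1 - lam * γop) ^ 2) + 1) / 2) * ((((5 * (κ₂ ^ 4 * γop
              ^ 2) / (1 - lam * γop) ^ 2) + 1) / 2) + (5 *
          (κ₂ ^ 4 * γop ^ 2) / (1 - lam * γop) ^ 2))) *
        ((r x y ^ 2)⁻¹ * (r x z ^ 2)⁻¹ * (r x t ^ 2)⁻¹ + (r x y ^ 2)⁻¹ * (r y z ^ 2)⁻¹ * (r y t ^ 2)⁻¹ + (r x z ^ 2)⁻¹ * (r y z ^ 2)⁻¹ * (r z t ^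
            2)⁻¹ + (r x t ^ 2)⁻¹ * (r y t ^ 2)⁻¹ * (r z t ^ 2)⁻¹ + (r x y ^ 2)⁻¹ * (r y z ^ 2)⁻¹ * (r z t ^ 2)⁻¹ + (r x y ^ 2)⁻¹ * (r y t ^ 2)⁻¹ * (r
            z t ^ 2)⁻¹ + (r x z ^ 2)⁻¹ * (r y z ^ 2)⁻¹ * (r y t ^ 2)⁻¹ + (r x z ^ 2)⁻¹ * (r y t ^ 2)⁻¹ * (r z t ^ 2)⁻¹ + (r x t ^ 2)⁻¹ * (r y z ^
            2)⁻¹ * (r y t ^ 2)⁻¹ + (r x t ^ 2)⁻¹ * (r y z ^ 2)⁻¹ * (r z t ^ 2)⁻¹ + (r x y ^ 2)⁻¹ * (r x z ^ 2)⁻¹ * (r z t ^ 2)⁻¹ + (r x y ^ 2)⁻¹ * (r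
            x t ^ 2)⁻¹ * (r z t ^ 2)⁻¹ + (r x y ^ 2)⁻¹ * (r x z ^ 2)⁻¹ * (r y t ^ 2)⁻¹ + (r x z ^ 2)⁻¹ * (r x t ^ 2)⁻¹ * (r y t ^ 2)⁻¹ + (r x y ^
            2)⁻¹ * (r x t ^ 2)⁻¹ * (r y z ^ 2)⁻¹ + (r x z ^ 2)⁻¹ * (r x t ^ 2)⁻¹ * (r y z ^ 2)⁻¹)) ≤
      k4s3 + (2 * (αr * k4s3 * (αc * hc)) + hr * αr * (αc * k4c) + αr * k4s3 * (αc * hc) + 3 * (αr * k3m * (αc * k3c))) * dr * dc / (1 - lamA) +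
        6 * ((n : ℝ) * ((4 * Real.sqrt ((5 * ((κ₂ ^ 4 + κ₃ ^ 4) * γop ^ 2) / (1 - lam * γop) ^ 2) * (αθ * dθ * (βθ * dθ') / (1 - lamA)))) * S ^ 2)) +
            (4 * (αθ * dθ * (βθ * dθ') / (1 - lamA)) + 3 * (αθ * dθ * (βθ * dθ') / (1 - lamA)) ^ 2 + 4 * (5 * (κ₂ ^ 4 * γop ^ 2) / (1 - lam * γop) ^
            2) + 4
          * (50 * (κ₂ ^ 6 * γop ^ 3) / (1 - lam * γop) ^ 3) + 2 * (((5 * (κ₂ ^ 4 * γop ^ 2) / (1 - lam * γop) ^ 2) + 1) / 2) * ((((5 * (κ₂ ^ 4 * γop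
              ^ 2) / (1 - lam * γop) ^ 2) + 1) / 2) + (5 *
          (κ₂ ^ 4 * γop ^ 2) / (1 - lam * γop) ^ 2))) * (16 * S' ^ 3) := by
  have hl1 : 0 < 1 - lamA := by linarith
  exact entry_majorant4_slot_four hK40 hK30 hHk0 hαr hαc hhr hhc hk3c hk3m hk4c hk4s3 hρsymm hn hn' hrsymm hSr hD hDr hDc hl1 hC3 hC4 hρ1 hS t

end TheEnds

/-! ## §2. Toy -/

/-- Toy (the letters' arithmetic): equal slot letters `k` of a symmetric input give `k + 6(…)` shapes — here `3k + k + 3k = 7k`. -/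
example (k : ℝ) : 3 * k + k + 3 * k = 7 * k := by ring

end Summit.QuantumFields.BalabanUV.T4Continuum.NE7b.SupKernelClassFourthLetters

end
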